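import Summits.Ventures.LatticeQCDFlow.Exactness.FlowSamplerOperator
import HarnessLib

/-!
# A bounded importance weight is an `L²` spectral gap of the flow sampler: `‖K g‖ ≤ (1 − W⁻¹)‖g‖` on mean-zero `g`

HONEST FRAMING: exact (Metropolis-corrected) sampling algorithms for lattice gauge theory;
figures of merit are autocorrelation/cost numbers at stated couplings and volumes; no
continuum-physics claim.  (SCALAR calibration rung S0-A: not a gauge result.)

Venture `LatticeQCDFlow` (cell pub-lqcd), topic `Exactness`; FANOUT row 2 (`s0-phi4`, FLOW arm:
real-NVP proposals + independence-Metropolis accept/reject).  NEW WORK of the cell over Mathlib and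
row 2's `Exactness/Phi4IndependenceSamplerExact.lean` (`imh_integral_invariant`: the sampler
preserves `w dμ` in integrated form) via `Exactness/FlowSamplerOperator.lean`; nothing is cited as a fact.  Printed counterparts, named
only: Mengersen–Tweedie 1996 Thm 2.1 and Smith–Tierney 1996 (the independence sampler with
`sup π/q = W < ∞` has spectral gap `1/W`), Liu 1996 (eigen-analysis of Metropolised independence
sampling), Sokal 1989/1997 (`τ_int ≤ (1 + Λ)/(2(1 − Λ))` from a bound `Λ` on the autocorrelations).

`Exactness/Phi4FlowSamplerErgodic.lean` (row 2) turned the weight bound `w ≤ C q` into UNIFORM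
ERGODICITY in total variation (Doeblin).  The S0 figure of merit is not a TV distance but an
AUTOCORRELATION time / effective sample size of observables along the stationary chain; this file
proves the `L²(w dμ)` statement those need.

## What is proved (general measure space `(X, μ)`, `μ` s-finite; target weight `w > 0` integrable,
`Z = ∫ w dμ`; proposal density `q > 0`, `∫ q dμ = 1`; the sampler's operator
`imhOp μ w q g (t) = ∫ [α g(t') + (1 − α) g(t)] q(t') dμ(t')`, `α = imhAcceptQ w q t t' = min(1, w(t')q(t)/(w(t)q(t')))`)

* (toolbox in `Exactness/FlowSamplerOperator.lean`: the operator `imhOp`, its sup-norm bound,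
  measurability, invariance `∫ (K g) w = ∫ g w`, the minorisation `w(t')/C ≤ α(t,t') q(t')` from
  `w ≤ C q`, and a weighted Cauchy–Schwarz inequality.)
* **`imhOp_sq_le`** (pointwise) — for bounded measurable `g` with `∫ g w dμ = 0`:
  `(K g)(t)² ≤ (1 − Z/C) · [K(g²)(t) − C⁻¹ ∫ g² w dμ]`;
  **`integral_imhOp_sq_le`** — integrating against `w`:
  `∫ (K g)² w dμ ≤ (1 − Z/C)² ∫ g² w dμ`, i.e. `‖K‖_{L²₀(w)} ≤ 1 − W⁻¹` with `W = C/Z` the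
  normalised weight bound; **`integral_imhOp_iterate_sq_le`** — `∫ (Kⁿ g)² w ≤ (1 − Z/C)^{2n} ∫ g² w`
  (the iterates stay bounded, measurable and mean-zero: `imhOp_iterate_invariants`).

The companion `Exactness/FlowSamplerAutocorrelation.lean` turns this into
`|C_g(n)| ≤ (1 − W⁻¹)ⁿ C_g(0)` and `τ_int ≤ W − ½` and instantiates it for the φ⁴ flow sampler.
NOT CLAIMED: lower bounds on the gap, the exact spectrum (Smith–Tierney), anything for unbounded
weights (there the gap is `0`: `Exactness/Phi4FlowSamplerSticking.lean`).
-/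

namespace Summit.Ventures.LatticeQCDFlow.Exactness

open Real MeasureTheory Filter

variable {X : Type*} [MeasurableSpace X] {μ : Measure X}

/-! ## The one-step `L²(w)` contraction on mean-zero observables -/

section Contraction

variable [SFinite μ] {w q : X → ℝ}

omit [SFinite μ] in
/-- **Pointwise quadratic bound.**  `w ≤ C q`, `g` bounded measurable with `∫ g w dμ = 0`:
`(K g)(t)² ≤ (1 − Z/C) · (K(g²)(t) − C⁻¹ ∫ g² w dμ)`, `Z = ∫ w dμ`. -/
theorem imhOp_sq_le (hw0 : ∀ t, 0 < w t) (hwm : Measurable w) (hwi : Integrable w μ)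
    (hq0 : ∀ t, 0 < q t) (hqm : Measurable q) (hqi : Integrable q μ) (hq1 : ∫ t, q t ∂μ = 1)
    {C : ℝ} (hC : ∀ t, w t ≤ C * q t) {g : X → ℝ} (hgm : Measurable g) {B : ℝ}
    (hgb : ∀ t, |g t| ≤ B) (hg0 : ∫ t, g t * w t ∂μ = 0) (t : X) :
    imhOp μ w q g t ^ 2
      ≤ (1 - (∫ s, w s ∂μ) / C)
        * (imhOp μ w q (fun s => g s ^ 2) t - (∫ s, g s ^ 2 * w s ∂μ) / C) := by
  have hCpos : 0 < C := by
    have h := hC t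
    exact pos_of_mul_pos_left ((hw0 t).trans_le h) (hq0 t).le
  have hgb2 : ∀ s, |g s ^ 2| ≤ B ^ 2 := fun s => by
    rw [abs_of_nonneg (sq_nonneg _), ← sq_abs]
    exact pow_le_pow_left₀ (abs_nonneg _) (hgb s) 2
  -- the objects at the current state `t`
  set a : X → ℝ := fun t' => imhAcceptQ w q t t' with ha
  have ha0 : ∀ t', 0 ≤ a t' := fun t' => imhAcceptQ_nonneg hw0 hq0 t t'
  have ha1 : ∀ t', a t' ≤ 1 := fun t' => imhAcceptQ_le_one w q t t'
  have ham : Measurable a := (measurable_imhAcceptQ hwm hqm).comp (measurable_const.prodMk measurable_id)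
  set m : X → ℝ := fun t' => a t' * q t' - w t' / C with hm
  have hm0 : ∀ t', 0 ≤ m t' := fun t' => by
    simp only [hm]
    linarith [imhAcceptQ_mul_ge hw0 hq0 hC t t']
  have hmm : Measurable m := (ham.mul hqm).sub (hwm.div_const C)
  -- integrability in `t'`
  have haq : Integrable (fun t' => a t' * q t') μ := by
    refine Integrable.mono' hqi (ham.mul hqm).aestronglyMeasurable (Eventually.of_forall fun t' => ?_)
    rw [Real.norm_eq_abs, abs_mul, abs_of_nonneg (ha0 t'), abs_of_pos (hq0 t')]
    calc a t' * q t' ≤ 1 * q t' := mul_le_mul_of_nonneg_right (ha1 t') (hq0 t').le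
      _ = q t' := one_mul _
  have hmi : Integrable m μ := haq.sub (hwi.div_const C)
  have haqg : Integrable (fun t' => a t' * q t' * g t') μ := by
    refine Integrable.mono' (hqi.const_mul B) ((ham.mul hqm).mul hgm).aestronglyMeasurable
      (Eventually.of_forall fun t' => ?_)
    rw [Real.norm_eq_abs, abs_mul, abs_mul, abs_of_nonneg (ha0 t'), abs_of_pos (hq0 t')]
    calc a t' * q t' * |g t'| ≤ 1 * q t' * B :=
          mul_le_mul (mul_le_mul_of_nonneg_right (ha1 t') (hq0 t').le) (hgb t') (abs_nonneg _)
            (by rw [one_mul]; exact (hq0 t').le)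
      _ = B * q t' := by ring
  have haqg2 : Integrable (fun t' => a t' * q t' * g t' ^ 2) μ := by
    refine Integrable.mono' (hqi.const_mul (B ^ 2)) ((ham.mul hqm).mul (hgm.pow_const 2)).aestronglyMeasurable
      (Eventually.of_forall fun t' => ?_)
    rw [Real.norm_eq_abs, abs_mul, abs_mul, abs_of_nonneg (ha0 t'), abs_of_pos (hq0 t')]
    calc a t' * q t' * |g t' ^ 2| ≤ 1 * q t' * B ^ 2 :=
          mul_le_mul (mul_le_mul_of_nonneg_right (ha1 t') (hq0 t').le) (hgb2 t') (abs_nonneg _)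
            (by rw [one_mul]; exact (hq0 t').le)
      _ = B ^ 2 * q t' := by ring
  have hwg : Integrable (fun t' => w t' * g t') μ := by
    refine Integrable.mono' (hwi.mul_const B) (hwm.mul hgm).aestronglyMeasurable
      (Eventually.of_forall fun t' => ?_)
    rw [Real.norm_eq_abs, abs_mul, abs_of_pos (hw0 t')]
    exact mul_le_mul_of_nonneg_left (hgb t') (hw0 t').le
  have hwg2 : Integrable (fun t' => w t' * g t' ^ 2) μ := by
    refine Integrable.mono' (hwi.mul_const (B ^ 2)) (hwm.mul (hgm.pow_const 2)).aestronglyMeasurable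
      (Eventually.of_forall fun t' => ?_)
    rw [Real.norm_eq_abs, abs_mul, abs_of_pos (hw0 t')]
    exact mul_le_mul_of_nonneg_left (hgb2 t') (hw0 t').le
  -- the scalars
  set Z := ∫ s, w s ∂μ with hZ
  set r := 1 - ∫ t', a t' * q t' ∂μ with hr
  set U := ∫ t', m t' ∂μ with hU
  set u := ∫ t', m t' * g t' ∂μ with hu
  set v := ∫ t', m t' * g t' ^ 2 ∂μ with hv
  have hr0 : 0 ≤ r := by
    have h : ∫ t', a t' * q t' ∂μ ≤ ∫ t', q t' ∂μ :=
      integral_mono haq hqi fun t' => by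
        calc a t' * q t' ≤ 1 * q t' := mul_le_mul_of_nonneg_right (ha1 t') (hq0 t').le
          _ = q t' := one_mul _
    rw [hq1] at h
    rw [hr]
    linarith
  have hU0 : 0 ≤ U := integral_nonneg hm0
  have hv0 : 0 ≤ v := integral_nonneg fun t' => mul_nonneg (hm0 t') (sq_nonneg _)
  have hUr : U + r = 1 - Z / C := by
    have e : U = (∫ t', a t' * q t' ∂μ) - Z / C := by
      rw [hU]
      simp only [hm]
      rw [integral_sub haq (hwi.div_const C), integral_div]
    rw [e, hr]
    ring
  -- `K g (t) = u + r g(t)` (uses `∫ g w = 0`)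
  have hwg0 : ∫ t', w t' * g t' ∂μ = 0 := by
    rw [← hg0]
    exact integral_congr_ae (Eventually.of_forall fun t' => mul_comm _ _)
  have hKg : imhOp μ w q g t = u + r * g t := by
    unfold imhOp
    have e : ∀ t', (imhAcceptQ w q t t' * g t' + (1 - imhAcceptQ w q t t') * g t) * q t'
        = a t' * q t' * g t' + g t * (q t' - a t' * q t') := by
      intro t'; simp only [ha]; ring
    simp_rw [e]
    have hqaq : Integrable (fun t' => q t' - a t' * q t') μ := hqi.sub haq
    rw [integral_add haqg (hqaq.const_mul _), integral_const_mul, integral_sub hqi haq, hq1]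
    have e2 : ∫ t', a t' * q t' * g t' ∂μ = u + (∫ t', w t' * g t' ∂μ) / C := by
      rw [hu]
      simp only [hm]
      have e3 : ∀ t', (a t' * q t' - w t' / C) * g t' = a t' * q t' * g t' - w t' * g t' / C := by
        intro t'; ring
      simp_rw [e3]
      rw [integral_sub haqg (hwg.div_const C), integral_div]
      ring
    rw [e2, hwg0, zero_div, add_zero, hr]
    ring
  -- `K(g²)(t) − (∫ w g²)/C = v + r g(t)²`
  have hKg2 : imhOp μ w q (fun s => g s ^ 2) t - (∫ s, g s ^ 2 * w s ∂μ) / C = v + r * g t ^ 2 := by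
    unfold imhOp
    have e : ∀ t', (imhAcceptQ w q t t' * g t' ^ 2 + (1 - imhAcceptQ w q t t') * g t ^ 2) * q t'
        = a t' * q t' * g t' ^ 2 + g t ^ 2 * (q t' - a t' * q t') := by
      intro t'; simp only [ha]; ring
    simp_rw [e]
    have hqaq : Integrable (fun t' => q t' - a t' * q t') μ := hqi.sub haq
    rw [integral_add haqg2 (hqaq.const_mul _), integral_const_mul, integral_sub hqi haq, hq1]
    have e2 : ∫ t', a t' * q t' * g t' ^ 2 ∂μ = v + (∫ t', w t' * g t' ^ 2 ∂μ) / C := by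
      rw [hv]
      simp only [hm]
      have e3 : ∀ t', (a t' * q t' - w t' / C) * g t' ^ 2
          = a t' * q t' * g t' ^ 2 - w t' * g t' ^ 2 / C := by
        intro t'; ring
      simp_rw [e3]
      rw [integral_sub haqg2 (hwg2.div_const C), integral_div]
      ring
    have e4 : ∫ s, g s ^ 2 * w s ∂μ = ∫ t', w t' * g t' ^ 2 ∂μ :=
      integral_congr_ae (Eventually.of_forall fun t' => mul_comm _ _)
    rw [e2, e4, hr]
    ring
  -- Cauchy–Schwarz and the quadratic-form step
  have hCS : u ^ 2 ≤ U * v := sq_integral_le_integral_mul_integral hm0 hmm hmi hgm hgb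
  rw [hKg, hKg2, ← hUr]
  exact sq_add_mul_le hU0 hr0 hv0 hCS

/-- **ONE-STEP `L²(w)` CONTRACTION ON MEAN-ZERO OBSERVABLES.**  Target weight `w > 0` integrable
(`Z = ∫ w dμ`), proposal density `q > 0` with `∫ q dμ = 1`, weight bound `w ≤ C q`.  For every
bounded measurable `g` with `∫ g w dμ = 0`:
`∫ (K g)² w dμ ≤ (1 − Z/C)² ∫ g² w dμ` — the flow sampler's operator has norm at most `1 − W⁻¹`
(`W = C/Z`) on the orthogonal complement of the constants. -/
theorem integral_imhOp_sq_le (hw0 : ∀ t, 0 < w t) (hwm : Measurable w) (hwi : Integrable w μ)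
    (hq0 : ∀ t, 0 < q t) (hqm : Measurable q) (hqi : Integrable q μ) (hq1 : ∫ t, q t ∂μ = 1)
    {C : ℝ} (hC : ∀ t, w t ≤ C * q t) {g : X → ℝ} (hgm : Measurable g) {B : ℝ}
    (hgb : ∀ t, |g t| ≤ B) (hg0 : ∫ t, g t * w t ∂μ = 0) :
    ∫ t, imhOp μ w q g t ^ 2 * w t ∂μ ≤ (1 - (∫ s, w s ∂μ) / C) ^ 2 * ∫ t, g t ^ 2 * w t ∂μ := by
  have hgb2 : ∀ s, |g s ^ 2| ≤ B ^ 2 := fun s => by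
    rw [abs_of_nonneg (sq_nonneg _), ← sq_abs]
    exact pow_le_pow_left₀ (abs_nonneg _) (hgb s) 2
  have hKm : Measurable (imhOp μ w q g) := measurable_imhOp hwm hqm hgm
  have hK2m : Measurable (imhOp μ w q fun s => g s ^ 2) := measurable_imhOp hwm hqm (hgm.pow_const 2)
  have hKb : ∀ t, |imhOp μ w q g t| ≤ B := imhOp_abs_le hw0 hq0 hqi hq1 hgb
  have hK2b : ∀ t, |imhOp μ w q (fun s => g s ^ 2) t| ≤ B ^ 2 := imhOp_abs_le hw0 hq0 hqi hq1 hgb2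
  -- integrate the pointwise bound against `w`
  have hL : Integrable (fun t => imhOp μ w q g t ^ 2 * w t) μ := by
    refine Integrable.mono' (hwi.const_mul (B ^ 2)) ((hKm.pow_const 2).mul hwm).aestronglyMeasurable
      (Eventually.of_forall fun t => ?_)
    rw [Real.norm_eq_abs, abs_mul, abs_of_pos (hw0 t), abs_of_nonneg (sq_nonneg _)]
    refine mul_le_mul_of_nonneg_right ?_ (hw0 t).le
    rw [← sq_abs]
    exact pow_le_pow_left₀ (abs_nonneg _) (hKb t) 2
  have hR : Integrable (fun t => (1 - (∫ s, w s ∂μ) / C)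
      * (imhOp μ w q (fun s => g s ^ 2) t - (∫ s, g s ^ 2 * w s ∂μ) / C) * w t) μ := by
    have h1 : Integrable (fun t => imhOp μ w q (fun s => g s ^ 2) t * w t) μ := by
      refine Integrable.mono' (hwi.const_mul (B ^ 2)) (hK2m.mul hwm).aestronglyMeasurable
        (Eventually.of_forall fun t => ?_)
      rw [Real.norm_eq_abs, abs_mul, abs_of_pos (hw0 t)]
      exact mul_le_mul_of_nonneg_right (hK2b t) (hw0 t).le
    have e : (fun t => (1 - (∫ s, w s ∂μ) / C)
        * (imhOp μ w q (fun s => g s ^ 2) t - (∫ s, g s ^ 2 * w s ∂μ) / C) * w t)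
        = fun t => (1 - (∫ s, w s ∂μ) / C) * (imhOp μ w q (fun s => g s ^ 2) t * w t)
          - (1 - (∫ s, w s ∂μ) / C) * ((∫ s, g s ^ 2 * w s ∂μ) / C) * w t := by
      funext t; ring
    rw [e]
    exact (h1.const_mul _).sub (hwi.const_mul _)
  have hmono : ∫ t, imhOp μ w q g t ^ 2 * w t ∂μ
      ≤ ∫ t, (1 - (∫ s, w s ∂μ) / C)
          * (imhOp μ w q (fun s => g s ^ 2) t - (∫ s, g s ^ 2 * w s ∂μ) / C) * w t ∂μ :=
    integral_mono hL hR fun t =>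
      mul_le_mul_of_nonneg_right (imhOp_sq_le hw0 hwm hwi hq0 hqm hqi hq1 hC hgm hgb hg0 t) (hw0 t).le
  refine hmono.trans_eq ?_
  -- evaluate the right-hand side with the invariance `∫ K(g²) w = ∫ g² w`
  have hinv : ∫ t, imhOp μ w q (fun s => g s ^ 2) t * w t ∂μ = ∫ t, g t ^ 2 * w t ∂μ :=
    integral_imhOp_mul hw0 hwm hwi hq0 hqm hqi hq1 (hgm.pow_const 2) hgb2
  have h1 : Integrable (fun t => imhOp μ w q (fun s => g s ^ 2) t * w t) μ := by
    refine Integrable.mono' (hwi.const_mul (B ^ 2)) (hK2m.mul hwm).aestronglyMeasurable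
      (Eventually.of_forall fun t => ?_)
    rw [Real.norm_eq_abs, abs_mul, abs_of_pos (hw0 t)]
    exact mul_le_mul_of_nonneg_right (hK2b t) (hw0 t).le
  have e : ∀ t, (1 - (∫ s, w s ∂μ) / C)
      * (imhOp μ w q (fun s => g s ^ 2) t - (∫ s, g s ^ 2 * w s ∂μ) / C) * w t
      = (1 - (∫ s, w s ∂μ) / C) * (imhOp μ w q (fun s => g s ^ 2) t * w t)
        - (1 - (∫ s, w s ∂μ) / C) * ((∫ s, g s ^ 2 * w s ∂μ) / C) * w t := by
    intro t; ring
  simp_rw [e]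
  rw [integral_sub (h1.const_mul _) (hwi.const_mul _), integral_const_mul, integral_const_mul, hinv]
  ring

/-- The iterates of `K` on a bounded measurable mean-zero observable stay bounded, measurable and
mean-zero. -/
theorem imhOp_iterate_invariants (hw0 : ∀ t, 0 < w t) (hwm : Measurable w) (hwi : Integrable w μ)
    (hq0 : ∀ t, 0 < q t) (hqm : Measurable q) (hqi : Integrable q μ) (hq1 : ∫ t, q t ∂μ = 1)
    {B : ℝ} : ∀ (n : ℕ) {g : X → ℝ}, Measurable g → (∀ t, |g t| ≤ B) → ∫ t, g t * w t ∂μ = 0 →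
      Measurable ((imhOp μ w q)^[n] g) ∧ (∀ t, |((imhOp μ w q)^[n] g) t| ≤ B)
        ∧ ∫ t, ((imhOp μ w q)^[n] g) t * w t ∂μ = 0
  | 0, g, hgm, hgb, hg0 => by simpa using ⟨hgm, hgb, hg0⟩
  | n + 1, g, hgm, hgb, hg0 => by
    rw [Function.iterate_succ_apply]
    refine imhOp_iterate_invariants hw0 hwm hwi hq0 hqm hqi hq1 n (measurable_imhOp hwm hqm hgm)
      (imhOp_abs_le hw0 hq0 hqi hq1 hgb) ?_
    rw [integral_imhOp_mul hw0 hwm hwi hq0 hqm hqi hq1 hgm hgb, hg0]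

/-- **`n`-STEP CONTRACTION**: `∫ (Kⁿ g)² w dμ ≤ ((1 − Z/C)²)ⁿ ∫ g² w dμ` for every bounded measurable
mean-zero `g`. -/
theorem integral_imhOp_iterate_sq_le (hw0 : ∀ t, 0 < w t) (hwm : Measurable w)
    (hwi : Integrable w μ) (hq0 : ∀ t, 0 < q t) (hqm : Measurable q) (hqi : Integrable q μ)
    (hq1 : ∫ t, q t ∂μ = 1) {C : ℝ} (hC : ∀ t, w t ≤ C * q t) {B : ℝ} :
    ∀ (n : ℕ) {g : X → ℝ}, Measurable g → (∀ t, |g t| ≤ B) → ∫ t, g t * w t ∂μ = 0 →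
      ∫ t, ((imhOp μ w q)^[n] g) t ^ 2 * w t ∂μ
        ≤ ((1 - (∫ s, w s ∂μ) / C) ^ 2) ^ n * ∫ t, g t ^ 2 * w t ∂μ
  | 0, g, _, _, _ => by simp
  | n + 1, g, hgm, hgb, hg0 => by
    rw [Function.iterate_succ_apply]
    have hKm := measurable_imhOp (μ := μ) hwm hqm hgm
    have hKb := imhOp_abs_le (μ := μ) hw0 hq0 hqi hq1 hgb
    have hK0 : ∫ t, imhOp μ w q g t * w t ∂μ = 0 := by
      rw [integral_imhOp_mul hw0 hwm hwi hq0 hqm hqi hq1 hgm hgb, hg0]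
    calc ∫ t, ((imhOp μ w q)^[n] (imhOp μ w q g)) t ^ 2 * w t ∂μ
        ≤ ((1 - (∫ s, w s ∂μ) / C) ^ 2) ^ n * ∫ t, imhOp μ w q g t ^ 2 * w t ∂μ :=
          integral_imhOp_iterate_sq_le hw0 hwm hwi hq0 hqm hqi hq1 hC n hKm hKb hK0
      _ ≤ ((1 - (∫ s, w s ∂μ) / C) ^ 2) ^ n
            * ((1 - (∫ s, w s ∂μ) / C) ^ 2 * ∫ t, g t ^ 2 * w t ∂μ) :=
          mul_le_mul_of_nonneg_left
            (integral_imhOp_sq_le hw0 hwm hwi hq0 hqm hqi hq1 hC hgm hgb hg0)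
            (pow_nonneg (sq_nonneg _) n)
      _ = ((1 - (∫ s, w s ∂μ) / C) ^ 2) ^ (n + 1) * ∫ t, g t ^ 2 * w t ∂μ := by ring

end Contraction

end Summit.Ventures.LatticeQCDFlow.Exactness
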